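import Mathlib
import Summits.NavierStokesRegularity.NavierStokesRegularity.Theorems.TaoLadderRungTwoBreakOneShiftWindowCert
import Summits.NavierStokesRegularity.NavierStokesRegularity.Theorems.TaoLadderRungTwoBreakOneShiftT4W76Certificate
import HarnessLib

/-!
# The one-shift instance T4 @ ε₀ = 1/10, W = 76: the window certificate CONSTRUCTED, and the certificate side
# restated as eight quantitative clauses about kernel-defined objects (cell harvest/h2-tao-ladder, seat p2;
# rung1/RUNG1-P2G9-REPORT.md §37/§40; support for K1(1) = `NoSurvivingDSSOne`, stmt-NavierStokesRegularity-20205)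

MODEL lattice only (comparable circuit table T4, scale ratio `11/10`); nothing here is a statement about the
Navier–Stokes equations; no item is closed.

`T4W76.exists_surviving_dssWave_of_certificate` (module …OneShiftT4W76Certificate) turns a term of
`T4W76.Certificate bd` — a window certificate `cert : OneShiftWindowCert (frame bd) (1/10) αT4` plus eight
quantitative clauses about `cert` — into a surviving admissible DSS blow-up wave of the T4 lattice. Here:

* `T4W76.windowCert bd C hC : OneShiftWindowCert (frame bd) (1/10) αT4` is CONSTRUCTED for the frame of the row
  and every preconditioner `C` with `C r = 0 → r = 0` (parts I–IV: the window run exists on the whole flight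
  by the energy bound — T4 is cancelling (`isCancellingCoeff_circuitTable`), the wake tube fits under `Eb = 7/10`
  (`ĝ·c_max + g_hi (r₀ + κ) = 0.69830 ≤ 0.7`), the top tube under `Et = ε`);
* `T4W76.ClausesFor bd C hC` — the eight quantitative clauses of `Certificate` for THIS certificate;
  `certificateOfClauses` packages them, and `exists_surviving_dssWave_of_clauses` /
  `exists_inTableClass_surviving_dssWave_of_clauses` conclude.

So for this row the certificate side of RUNG1-P2G9-REPORT §37 is now: choose a preconditioner `C` (the
engine's is `mid(DG)⁻¹`, 305 × 305) and prove eight inequalities about the kernel-defined window-run map and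
Krawczyk map — no existence clause and no opaque `Nmap` remain. Those eight inequalities are what the interval
engine (v7.5, unaudited) asserts with its printed numbers; nothing here proves them.
-/

noncomputable section

-- the sub-problem namespace repeats the summit name by design (D-0017)
set_option linter.dupNamespace false

namespace Summit.NavierStokesRegularity.NavierStokesRegularity.Theorems

namespace DSSOneShift

open Set Literature.Analysis.FluidPDE Literature.Analysis.FluidPDE.TaoCascade CertificateGlueOn
open OneShiftFrame

namespace T4W76

/-- The wake tube at shell `-1` fits under the edge bound: `|ĝ ŷ_{i,0}| + g_hi (r₀ + κ) ≤ 7/10`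
(`0.69813 + 0.00017 = 0.69830`). [cite: Tao2016AveragedNS, §4; cell vocabulary, harvest/h2-tao-ladder rung1/INSTANCE-SHEET-T4-0.1-W76.md (Frame: Eb = 0.7)] -/
theorem tube_edge_bot (bd : BoxData) (i : Fin 4) :
    |(frame bd).tubeC i (-1)| + (frame bd).tubeR (-1) ≤ (frame bd).Eb := by
  have hc := bd.yc_le i
  have h1 : (frame bd).tubeC i (-1) = ghat ^ (0 + 1) * bd.yc i 0 := by
    rw [frame_tubeC]; exact_mod_cast tubeCT4_wake (fun i => bd.yc i 0) i 0
  have h2 : (frame bd).tubeR (-1) = gHi ^ (0 + 1) * (r₀ + κw * (((0 : ℕ) : ℝ) + 1)) := by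
    rw [frame_tubeR]; exact_mod_cast tubeRT4_wake 0
  have h3 : (frame bd).Eb = 7 / 10 := rfl
  rw [h1, h2, h3, abs_mul]
  unfold cmax at hc
  unfold ghat gHi r₀ κw
  norm_num
  nlinarith [abs_nonneg (bd.yc i 0)]

/-- The top tube at shell `76` fits under the edge bound: `0 + ε ≤ ε`. [cite: Tao2016AveragedNS, §4; cell vocabulary, harvest/h2-tao-ladder rung1/INSTANCE-SHEET-T4-0.1-W76.md (Frame: Et = ε)] -/
theorem tube_edge_top (bd : BoxData) (i : Fin 4) :
    |(frame bd).tubeC i (frame bd).W| + (frame bd).tubeR (frame bd).W ≤ (frame bd).Et := by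
  have h1 : (frame bd).tubeC i (frame bd).W = 0 := by
    rw [frame_tubeC, frame_W]; exact_mod_cast tubeCT4_top (fun i => bd.yc i 0) i 0
  have h2 : (frame bd).tubeR (frame bd).W = εR * (1 / 2) ^ (0 : ℕ) := by
    rw [frame_tubeR, frame_W]; exact_mod_cast tubeRT4_top 0
  have h3 : (frame bd).Et = εR := rfl
  rw [h1, h2, h3]
  simp

/-- `0 < W = 76`. [folklore] -/
theorem frame_W_pos (bd : BoxData) : 0 < (frame bd).W := by
  rw [frame_W']; norm_num

/-- **THE WINDOW CERTIFICATE OF THE ROW T4 @ 1/10, W = 76, CONSTRUCTED** for the frame `frame bd` and any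
preconditioner `C` of the window block with `C r = 0 → r = 0`: window-run map = the window run that exists on the
whole flight (parts I–III), Krawczyk map `(y,τ) ↦ (y,τ) − C(G_T(y,τ))` (part IV).
[cite: Tao2016AveragedNS, §4 Lemma 4.1 (4.8), §5.3; cell vocabulary, harvest/h2-tao-ladder rung1/RUNG1-P2G9-REPORT.md §37/§40] -/
def windowCert (bd : BoxData) (C : (frame bd).WState × ℝ → (frame bd).WState × ℝ)
    (hC : ∀ r, C r = 0 → r = 0) : OneShiftWindowCert (frame bd) (1 / 10) αT4 :=
  (frame bd).windowCertOfMatrix (by norm_num) (frame_W_pos bd) (isCancellingCoeff_circuitTable _ _ _ _ _) (tube_edge_bot bd)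
    (tube_edge_top bd) C hC

/-- **The eight quantitative clauses of the certificate side for the CONSTRUCTED window certificate** (engine
v7.5 printed numbers of kit j304110, as in `T4W76.Certificate`): window amplitude hulls, `g`-hull, window-block
edge-form Lipschitz bound (`Z = 8.62e-4`, `S_b = 7.89e-4`, `S_e = 1.8856e24`), `g` and shell-`0` edge-form bounds,
per-shell bounds, Krawczyk inclusion, wake entry `A₁ = 2.26e-6`. Hypothesis structure; nothing here proves it.
[cite: Tao2016AveragedNS, §4 Lemma 4.1 (4.8), §5.3; cell vocabulary, harvest/h2-tao-ladder rung1/RUNG1-P2G9-REPORT.md §37] -/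
structure ClausesFor (bd : BoxData) (C : (frame bd).WState × ℝ → (frame bd).WState × ℝ)
    (hC : ∀ r, C r = 0 → r = 0) where
  /-- window amplitude hulls -/
  hAwin : ∀ w, (frame bd).Adm w → ∀ j k', (frame bd).InWindow k' → ∀ s ∈ Icc 0 (frame bd).τhi,
    |(frame bd).fullFamily (windowCert bd C hC) w j k' s| ≤ AT4 k'
  /-- the hull of the renormalisation factor -/
  hgl : ∀ w, (frame bd).Adm w →
    gLo ≤ gfac (slice ((frame bd).fullFamily (windowCert bd C hC) w) ((frame bd).decodeTau w)) ∧
    gfac (slice ((frame bd).fullFamily (windowCert bd C hC) w) ((frame bd).decodeTau w)) ≤ gHi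
  /-- window block, edge form -/
  hWedge : ∀ u v, (frame bd).AdmLip RT4 u → (frame bd).AdmLip RT4 v → ∀ B E : ℝ,
    (∀ i, ∀ t ∈ Icc 0 (frame bd).τhi, |(frame bd).decodeTail u i (-1) t - (frame bd).decodeTail v i (-1) t| ≤ B) →
    (∀ i, ∀ t ∈ Icc 0 (frame bd).τhi,
    |(frame bd).decodeTail u i (frame bd).W t - (frame bd).decodeTail v i (frame bd).W t| ≤ E) →
    dist ((frame bd).rawWindow (windowCert bd C hC) u) ((frame bd).rawWindow (windowCert bd C hC) v) ≤
    862 / 10 ^ 6 * dist u v + 789 / 10 ^ 6 * B + 18856 * 10 ^ 20 * E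
  /-- renormalisation factor, edge form -/
  hγedge : ∀ u v, (frame bd).AdmLip RT4 u → (frame bd).AdmLip RT4 v → ∀ B E : ℝ,
    (∀ i, ∀ t ∈ Icc 0 (frame bd).τhi, |(frame bd).decodeTail u i (-1) t - (frame bd).decodeTail v i (-1) t| ≤ B) →
    (∀ i, ∀ t ∈ Icc 0 (frame bd).τhi,
    |(frame bd).decodeTail u i (frame bd).W t - (frame bd).decodeTail v i (frame bd).W t| ≤ E) →
    |gfac (slice ((frame bd).fullFamily (windowCert bd C hC) u) ((frame bd).decodeTau u)) -
    gfac (slice ((frame bd).fullFamily (windowCert bd C hC) v) ((frame bd).decodeTau v))| ≤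
    1034 / 10 ^ 12 * dist u v + 437 / 10 ^ 17 * B + 1 / 10 ^ 60 * E
  /-- left-behind shell `0` at the moving flight time -/
  hZedge : ∀ u v, (frame bd).AdmLip RT4 u → (frame bd).AdmLip RT4 v → ∀ i, ∀ B E : ℝ,
    (∀ i, ∀ t ∈ Icc 0 (frame bd).τhi, |(frame bd).decodeTail u i (-1) t - (frame bd).decodeTail v i (-1) t| ≤ B) →
    (∀ i, ∀ t ∈ Icc 0 (frame bd).τhi,
    |(frame bd).decodeTail u i (frame bd).W t - (frame bd).decodeTail v i (frame bd).W t| ≤ E) →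
    |(frame bd).fullFamily (windowCert bd C hC) u i 0 ((frame bd).decodeTau u) -
    (frame bd).fullFamily (windowCert bd C hC) v i 0 ((frame bd).decodeTau v)| ≤
    676 / 10 ^ 12 * dist u v + 41 / 10 ^ 6 * B + 1 / 10 ^ 60 * E
  /-- every window shell along the flight -/
  hDedge : ∀ u v, (frame bd).AdmLip RT4 u → (frame bd).AdmLip RT4 v → ∀ j k', (frame bd).InWindow k' →
    ∀ s ∈ Icc 0 (frame bd).τhi, ∀ B E : ℝ,
    (∀ i, ∀ t ∈ Icc 0 (frame bd).τhi, |(frame bd).decodeTail u i (-1) t - (frame bd).decodeTail v i (-1) t| ≤ B) →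
    (∀ i, ∀ t ∈ Icc 0 (frame bd).τhi,
    |(frame bd).decodeTail u i (frame bd).W t - (frame bd).decodeTail v i (frame bd).W t| ≤ E) →
    |(frame bd).fullFamily (windowCert bd C hC) u j k' s - (frame bd).fullFamily (windowCert bd C hC) v j k' s| ≤
    vmaxT4 k' * dist u v + χbT4 k' * B + χeT4 k' * E
  /-- Krawczyk inclusion -/
  hwinIn : ∀ u, (frame bd).AdmLip RT4 u →
    (∀ i k, |((frame bd).rawWindow (windowCert bd C hC) u).1 i k| ≤ 1) ∧
    |((frame bd).rawWindow (windowCert bd C hC) u).2| ≤ 1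
  /-- wake entry -/
  hA1 : ∀ w, (frame bd).Adm w → ∀ i,
    |gfac (slice ((frame bd).fullFamily (windowCert bd C hC) w) ((frame bd).decodeTau w)) *
    (frame bd).fullFamily (windowCert bd C hC) w i 0 ((frame bd).decodeTau w) - (frame bd).tubeC i (-1)| ≤ 226 / 10 ^ 8

variable (bd : BoxData)

/-- The eight clauses about the constructed certificate ARE a `Certificate bd`. [cite: Tao2016AveragedNS, §4 Lemma 4.1 (4.8), §5.3; cell vocabulary, harvest/h2-tao-ladder rung1/RUNG1-P2G9-REPORT.md §37] -/
def certificateOfClauses {C : (frame bd).WState × ℝ → (frame bd).WState × ℝ} {hC : ∀ r, C r = 0 → r = 0}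
    (h : ClausesFor bd C hC) : Certificate bd where
  cert := windowCert bd C hC
  hAwin := h.hAwin
  hgl := h.hgl
  hWedge := h.hWedge
  hγedge := h.hγedge
  hZedge := h.hZedge
  hDedge := h.hDedge
  hwinIn := h.hwinIn
  hA1 := h.hA1

/-- **T4 @ 1/10, W = 76 with the window certificate CONSTRUCTED**: a preconditioner `C` and the eight
quantitative clauses about the kernel-defined window-run / Krawczyk maps yield a surviving admissible DSS
blow-up wave of the bi-infinite T4 lattice at `1 + ε₀ = 11/10`. Conditional on the clauses; model lattice
only; does not close stmt-20205 (single `(ε₀, α)`).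
[cite: Tao2016AveragedNS, §4 Lemma 4.1 (4.8), §5.3–§6; cell vocabulary, harvest/h2-tao-ladder rung1/RUNG1-P2G9-REPORT.md §35–§37, §40] -/
theorem exists_surviving_dssWave_of_clauses {C : (frame bd).WState × ℝ → (frame bd).WState × ℝ}
    {hC : ∀ r, C r = 0 → r = 0} (h : ClausesFor bd C hC) :
    ∃ (T : ℝ) (Φ : Unit → ℝ → Em 4), 0 < T ∧ IsDSSWave (1 / 10) αT4 (Equiv.refl Unit) T Φ ∧
      Surviving 1 (1 / 10) T ∧ ∃ x, Φ () x ≠ 0 :=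
  exists_surviving_dssWave_of_certificate bd (certificateOfClauses bd h)

/-- The same, packaged with the class membership `αT4 ∈ InTableClass 15`. [cite: Tao2016AveragedNS, §4 (4.2)–(4.3), §6.1; cell vocabulary (`InTableClass`), module …CircuitTableT4] -/
theorem exists_inTableClass_surviving_dssWave_of_clauses {C : (frame bd).WState × ℝ → (frame bd).WState × ℝ}
    {hC : ∀ r, C r = 0 → r = 0} (h : ClausesFor bd C hC) :
    ∃ α : Fin 4 → Fin 4 → Fin 4 → ℤ × ℤ × ℤ → ℝ, InTableClass 15 α ∧
      ∃ (T : ℝ) (Φ : Unit → ℝ → Em 4), 0 < T ∧ IsDSSWave (1 / 10) α (Equiv.refl Unit) T Φ ∧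
        Surviving 1 (1 / 10) T ∧ ∃ x, Φ () x ≠ 0 :=
  exists_inTableClass_surviving_dssWave_of_certificate bd (certificateOfClauses bd h)

end T4W76

end DSSOneShift

end Summit.NavierStokesRegularity.NavierStokesRegularity.Theorems
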